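import Literature.AlgebraicGeometry.HodgeTheory.MotivatedClassesDeformationInputs
import Literature.AlgebraicGeometry.HodgeTheory.GysinFormalismCorrespondences

/-!
# Route AnchorTransport — `VariationalHodge` (stmt-HodgeConjecture-1076): transport of the anchor by a flat family of algebraic operators

The crux `AnchorTransport.VariationalHodge` (Grothendieck's variational Hodge conjecture in
global-class form: `f : 𝒳 ⟶ S` a smooth projective family over a smooth irreducible base,
`A ∈ H²ᵖ(𝒳(ℂ); ℂ)` with rational `(p,p)` fibre restrictions, `A|_{𝒳_{s₀}}` algebraic at one complex
point `s₀` ⇒ `A|_{𝒳_t}` algebraic at every `t`) is proved, for a given `(f, A, s₀)`, as soon as the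
anchor class can be CARRIED to the other fibres by operators `T_t : H²ᵖ(𝒳_{s₀}) → H²ᵖ(𝒳_t)` that
(i) send algebraic classes to algebraic classes, (ii) applied to the anchor class glue to ONE global
class `Gl` on `𝒳` (`T_t (A|_{s₀}) = Gl|_{𝒳_t}` for all `t` — flatness of the transported family), and
(iii) fix the anchor at `s₀` (`T_{s₀} (A|_{s₀}) = A|_{s₀}`). For then `Gl` and `A` are two global
classes with the same restriction to `𝒳_{s₀}`, hence — the restrictions of a global class forming a
FLAT SECTION of the local system `R²ᵖ f_* ℂ` over the connected `S(ℂ)` — with the same restriction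
to every fibre, and `A|_{𝒳_t} = Gl|_{𝒳_t} = T_t (A|_{s₀})` is algebraic. This is the first lemma
`CorrespondenceTransport` of the crux's idea card `gw-section-transport` (operators = the actions
`[T_t]^*` of the fibres `T_t ⊂ 𝒳_t × 𝒳_{s₀}` of ONE algebraic cycle `T` on `𝒳 ×_S 𝒳_{s₀}`-type
carriers, e.g. two-point Gromov–Witten / section-transport correspondences; (ii) is then base change
for the proper projection, (iii) the "anchor coefficient" condition), isolated here in its abstract
form and PROVED on the tree's real carriers:

* `complexBetti_map_fiberι_eq_of_eq` — two global classes with the same restriction to ONE fibre of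
  a smooth projective family over a smooth irreducible separated quasi-compact base have the same
  restriction to EVERY fibre (Ehresmann on complex points + transport in `R^k f_* ℂ`, the tree's
  proved `complexBetti_map_fiberι_eq_zero_of_eq_zero`; `S(ℂ)` is connected because `S` is
  irreducible, SGA1 XII 2.4 = `ComplexPoints.connectedSpace_iff_holds`, and `S` is smooth of one
  relative dimension, `exists_smoothOfRelativeDimension_of_connectedSpace_complexPoints`);
* `mem_algebraicClasses_of_transportedAnchor` — the abstract transport theorem (i)+(ii)+(iii) ⇒
  algebraicity on every fibre, for ANY family of maps `T_t`;
* `correspondenceTransport` — the instance `T_t = γ_t^*` for classes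
  `γ_t ∈ H^{2n}((𝒳_t ⊗ 𝒳_{s₀})(ℂ); ℂ)` acting through a Gysin formalism `G`
  (`GysinFormalism.corrClassGen`, Voisin II (10.7)), i.e. the card's `CorrespondenceTransport G` with
  the honest extra hypotheses "`S` separated and quasi-compact" under which the flat-section
  argument is available (after the reductions of `AnchorTransportVariationalHodgeReductions` /
  `…CurveBase` the base is a smooth affine curve, so nothing is lost); `correspondenceTransport_affine`
  — the affine-base form.

No rationality or Hodge-type hypothesis on `A` is needed: the variational content is entirely in the
gluing hypothesis (ii).
-/

noncomputable section

-- every declaration of this problem lives in `Summit.HodgeConjecture.HodgeConjecture.…` (summit = sub-problem)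
set_option linter.dupNamespace false

open CategoryTheory AlgebraicGeometry TopologicalSpace MonoidalCategory
open Literature.AlgebraicGeometry.Motives Literature.AlgebraicGeometry.HodgeTheory

namespace Summit.HodgeConjecture.HodgeConjecture.Theorems

variable {n : ℕ} {𝒳 S : SchemeOver ℂ} (f : 𝒳 ⟶ S)

/-! ### Two global classes agreeing on one fibre agree on every fibre -/

/-- **Identity principle for restrictions of global classes.** Let `f : 𝒳 ⟶ S` be a smooth
projective family of relative dimension `n` over a smooth IRREDUCIBLE `ℂ`-scheme `S` which is
separated and quasi-compact, and `A, B ∈ Hᵏ(𝒳(ℂ); ℂ)`. If `A|_{𝒳_s} = B|_{𝒳_s}` for one complex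
point `s` then `A|_{𝒳_t} = B|_{𝒳_t}` for every complex point `t`: the restrictions of `A - B` form a
flat section of the local system `Rᵏ f_* ℂ` on the connected manifold `S(ℂ)` vanishing at `s`
(`complexBetti_map_fiberι_eq_zero_of_eq_zero`; `S(ℂ)` is connected since `S` is irreducible —
`ComplexPoints.connectedSpace_iff_holds`, SGA1 XII Prop. 2.4 — and then `S` is smooth of a single
relative dimension, `exists_smoothOfRelativeDimension_of_connectedSpace_complexPoints`).
[cite: VoisinHodgeII2003, §3.1.2] [cite: VoisinHodgeI2002, Thm. 9.3 and §9.2.1] -/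
theorem complexBetti_map_fiberι_eq_of_eq (hf : IsSmoothProjectiveFamily f n)
    [IrreducibleSpace S.left] [AlgebraicGeometry.Smooth S.hom] [IsSeparated S.hom]
    [CompactSpace S.left] (k : ℕ) (A B : complexBetti 𝒳 k) (s t : ComplexPoints S)
    (hs : complexBetti.map (fiberι f s) k A = complexBetti.map (fiberι f s) k B) :
    complexBetti.map (fiberι f t) k A = complexBetti.map (fiberι f t) k B := by
  haveI : ConnectedSpace (ComplexPoints S) := (ComplexPoints.connectedSpace_iff_holds S).2 inferInstance
  obtain ⟨m, hm⟩ := exists_smoothOfRelativeDimension_of_connectedSpace_complexPoints S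
  haveI := hm
  haveI := hf.smoothOfRelativeDimension
  haveI := hf.isProper
  have h0 : complexBetti.map (fiberι f s) k (A - B) = 0 := by rw [map_sub, hs, sub_self]
  have ht := complexBetti_map_fiberι_eq_zero_of_eq_zero f n m k (A - B) s t h0
  rwa [map_sub, sub_eq_zero] at ht

/-! ### The abstract transport theorem -/

/-- **Algebraicity of all fibre restrictions from a transported anchor.** Let `f : 𝒳 ⟶ S` be a
smooth projective family over a smooth irreducible separated quasi-compact `S`, `A ∈ H²ᵖ(𝒳(ℂ); ℂ)`,
`s₀ ∈ S(ℂ)` with `A|_{𝒳_{s₀}}` algebraic, and `T_t : H²ᵖ(𝒳_{s₀}(ℂ)) → H²ᵖ(𝒳_t(ℂ))` (`t ∈ S(ℂ)`) any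
maps which (i) send algebraic classes to algebraic classes, (ii) glue on the anchor class to a global
class `Gl` (`T_t (A|_{s₀}) = Gl|_{𝒳_t}` for all `t`), (iii) fix the anchor class at `s₀`. Then
`A|_{𝒳_t}` is algebraic for every `t`: by (ii) at `s₀` and (iii), `Gl|_{s₀} = A|_{s₀}`, so `Gl` and
`A` agree on every fibre (`complexBetti_map_fiberι_eq_of_eq`), and `A|_{𝒳_t} = T_t (A|_{s₀})` is
algebraic by (i). [folklore] -/
theorem mem_algebraicClasses_of_transportedAnchor (hf : IsSmoothProjectiveFamily f n)
    [IrreducibleSpace S.left] [AlgebraicGeometry.Smooth S.hom] [IsSeparated S.hom]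
    [CompactSpace S.left] (p : ℕ) (A : complexBetti 𝒳 (2 * p)) (s₀ : ComplexPoints S)
    (T : ∀ t : ComplexPoints S,
      complexBetti (fiberOver f s₀) (2 * p) → complexBetti (fiberOver f t) (2 * p))
    (halg : ∀ (t : ComplexPoints S) (c : complexBetti (fiberOver f s₀) (2 * p)),
      c ∈ algebraicClasses (fiberOver f s₀) p → T t c ∈ algebraicClasses (fiberOver f t) p)
    (hglue : ∃ Gl : complexBetti 𝒳 (2 * p), ∀ t : ComplexPoints S,
      T t (complexBetti.map (fiberι f s₀) (2 * p) A) = complexBetti.map (fiberι f t) (2 * p) Gl)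
    (hfix : T s₀ (complexBetti.map (fiberι f s₀) (2 * p) A) = complexBetti.map (fiberι f s₀) (2 * p) A)
    (hs₀ : complexBetti.map (fiberι f s₀) (2 * p) A ∈ algebraicClasses (fiberOver f s₀) p)
    (t : ComplexPoints S) :
    complexBetti.map (fiberι f t) (2 * p) A ∈ algebraicClasses (fiberOver f t) p := by
  obtain ⟨Gl, hGl⟩ := hglue
  -- `Gl` and `A` agree on the anchor fibre, hence on every fibre
  have h₀ : complexBetti.map (fiberι f s₀) (2 * p) Gl = complexBetti.map (fiberι f s₀) (2 * p) A := by
    rw [← hGl s₀, hfix]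
  have ht : complexBetti.map (fiberι f t) (2 * p) Gl = complexBetti.map (fiberι f t) (2 * p) A :=
    complexBetti_map_fiberι_eq_of_eq f hf (2 * p) Gl A s₀ t h₀
  rw [← ht, ← hGl t]
  exact halg t _ hs₀

/-! ### Correspondence classes acting through a Gysin formalism -/

/-- **Transport of the anchor by a flat family of algebraic correspondences** (first lemma
`CorrespondenceTransport` of the idea card `gw-section-transport`, with the base assumed separated and
quasi-compact). Let `G` be a Gysin formalism, `f : 𝒳 ⟶ S` a smooth projective family of relative
dimension `n` over a smooth irreducible separated quasi-compact `S`, `A ∈ H²ᵖ(𝒳(ℂ); ℂ)`, `s₀ ∈ S(ℂ)`,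
and `γ_t ∈ H^{2n}((𝒳_t ⊗ 𝒳_{s₀})(ℂ); ℂ)` (`t ∈ S(ℂ)`) classes acting as
`γ_t^* = pr_{𝒳_t *}(pr_{𝒳_{s₀}}^* (–) ∪ γ_t) : H²ᵖ(𝒳_{s₀}) → H²ᵖ(𝒳_t)` (`GysinFormalism.corrClassGen`,
Voisin II (10.7); in the intended instance the fibre restrictions of the class of ONE algebraic cycle
on a family of correspondences from the anchor fibre). If each `γ_t^*` preserves algebraic classes
(`halg`; for cycle classes this is `corrActGen_mem_algebraicClasses`, Voisin II Prop. 9.21), the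
transported anchor classes glue to a global class (`hglue`), and `γ_{s₀}^*` fixes the anchor class
(`hfix`), then algebraicity of `A|_{𝒳_{s₀}}` gives algebraicity of every `A|_{𝒳_t}`
(`mem_algebraicClasses_of_transportedAnchor`). [cite: VoisinHodgeII2003, proof of Thm. 10.17 (10.7) and Prop. 9.21] -/
theorem correspondenceTransport (G : GysinFormalism) (hf : IsSmoothProjectiveFamily f n)
    [IrreducibleSpace S.left] [AlgebraicGeometry.Smooth S.hom] [IsSeparated S.hom]
    [CompactSpace S.left] (p : ℕ) (A : complexBetti 𝒳 (2 * p)) (s₀ : ComplexPoints S)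
    (γ : ∀ t : ComplexPoints S, complexBetti (fiberOver f t ⊗ fiberOver f s₀) (2 * n))
    (halg : ∀ (t : ComplexPoints S) (c : complexBetti (fiberOver f s₀) (2 * p)),
      c ∈ algebraicClasses (fiberOver f s₀) p →
        G.corrClassGen (hf.isSmoothProjective t) (hf.isSmoothProjective s₀)
          (rfl : 2 * p + 2 * n = 2 * p + 2 * n) (γ t) c ∈ algebraicClasses (fiberOver f t) p)
    (hglue : ∃ Gl : complexBetti 𝒳 (2 * p), ∀ t : ComplexPoints S,
      G.corrClassGen (hf.isSmoothProjective t) (hf.isSmoothProjective s₀)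
          (rfl : 2 * p + 2 * n = 2 * p + 2 * n) (γ t) (complexBetti.map (fiberι f s₀) (2 * p) A) =
        complexBetti.map (fiberι f t) (2 * p) Gl)
    (hfix : G.corrClassGen (hf.isSmoothProjective s₀) (hf.isSmoothProjective s₀)
        (rfl : 2 * p + 2 * n = 2 * p + 2 * n) (γ s₀) (complexBetti.map (fiberι f s₀) (2 * p) A) =
      complexBetti.map (fiberι f s₀) (2 * p) A)
    (hs₀ : complexBetti.map (fiberι f s₀) (2 * p) A ∈ algebraicClasses (fiberOver f s₀) p)
    (t : ComplexPoints S) :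
    complexBetti.map (fiberι f t) (2 * p) A ∈ algebraicClasses (fiberOver f t) p :=
  mem_algebraicClasses_of_transportedAnchor f hf p A s₀
    (fun t c => G.corrClassGen (hf.isSmoothProjective t) (hf.isSmoothProjective s₀)
      (rfl : 2 * p + 2 * n = 2 * p + 2 * n) (γ t) c)
    halg hglue hfix hs₀ t

/-- **The same over an AFFINE base** (affine schemes are separated and quasi-compact) — the shape
in which a line works after the reduction of the crux to smooth irreducible affine (curve) bases.
[cite: VoisinHodgeII2003, proof of Thm. 10.17 (10.7) and Prop. 9.21] -/
theorem correspondenceTransport_affine (G : GysinFormalism) (hf : IsSmoothProjectiveFamily f n)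
    [IrreducibleSpace S.left] [AlgebraicGeometry.Smooth S.hom] [IsAffine S.left]
    (p : ℕ) (A : complexBetti 𝒳 (2 * p)) (s₀ : ComplexPoints S)
    (γ : ∀ t : ComplexPoints S, complexBetti (fiberOver f t ⊗ fiberOver f s₀) (2 * n))
    (halg : ∀ (t : ComplexPoints S) (c : complexBetti (fiberOver f s₀) (2 * p)),
      c ∈ algebraicClasses (fiberOver f s₀) p →
        G.corrClassGen (hf.isSmoothProjective t) (hf.isSmoothProjective s₀)
          (rfl : 2 * p + 2 * n = 2 * p + 2 * n) (γ t) c ∈ algebraicClasses (fiberOver f t) p)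
    (hglue : ∃ Gl : complexBetti 𝒳 (2 * p), ∀ t : ComplexPoints S,
      G.corrClassGen (hf.isSmoothProjective t) (hf.isSmoothProjective s₀)
          (rfl : 2 * p + 2 * n = 2 * p + 2 * n) (γ t) (complexBetti.map (fiberι f s₀) (2 * p) A) =
        complexBetti.map (fiberι f t) (2 * p) Gl)
    (hfix : G.corrClassGen (hf.isSmoothProjective s₀) (hf.isSmoothProjective s₀)
        (rfl : 2 * p + 2 * n = 2 * p + 2 * n) (γ s₀) (complexBetti.map (fiberι f s₀) (2 * p) A) =
      complexBetti.map (fiberι f s₀) (2 * p) A)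
    (hs₀ : complexBetti.map (fiberι f s₀) (2 * p) A ∈ algebraicClasses (fiberOver f s₀) p)
    (t : ComplexPoints S) :
    complexBetti.map (fiberι f t) (2 * p) A ∈ algebraicClasses (fiberOver f t) p := by
  haveI : IsAffineHom S.hom := inferInstance
  haveI : IsSeparated S.hom := inferInstance
  haveI : CompactSpace S.left := isCompact_univ_iff.mp (isAffineOpen_top S.left).isCompact
  exact correspondenceTransport f G hf p A s₀ γ halg hglue hfix hs₀ t

end Summit.HodgeConjecture.HodgeConjecture.Theorems

end
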